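import Literature.Topology.FourManifolds.LatticeForms
import HarnessLib

/-!
# Diagonalisability over `ℤ`: unimodular diagonalisable forms are `⊕ ⟨±1⟩`; the parity obstruction

Companion to `Literature.Topology.FourManifolds.LatticeForms` (same sources), making formal the
content of the docstring of `LinearMap.BilinForm.IsDiagonalizable` ("for a unimodular form this
says `Q ≅ ⊕ ⟨±1⟩`").

## `IsDiagonalizable` is a predicate, not a named fact

`LinearMap.BilinForm.IsDiagonalizable Q` — "`V` has a `Q`-orthogonal `ℤ`-basis" — is a *property of
the form `Q`* (the conclusion of Donaldson's theorem,
`Literature.Topology.FourManifolds.isDiagonalizable_intersectionForm_of_isDefinite`), not a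
published statement awaiting a proof: it is **false** for some unimodular lattices (the hyperbolic
plane, `not_isDiagonalizable_hyperbolicForm`; the `E₈` lattice, `not_isDiagonalizable_e8Form`
below), so there is no theorem `IsDiagonalizable_holds`. What Milnor–Husemoller and Serre do assert
about it, and what is proved here, is:

* in a `Q`-orthogonal basis `b` of a **unimodular** form each Gram diagonal entry `Q bᵢ bᵢ` is a
  unit, i.e. `±1` (the coordinate functional `bᵢ*` is of the form `Q x -` by unimodularity, and
  `Q x bᵢ = xᵢ · Q bᵢ bᵢ`), hence a unimodular form on a lattice that is diagonalisable over `ℤ` is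
  isometric to `⟨±1⟩ ⊕ ⋯ ⊕ ⟨±1⟩` on `ℤⁿ`, `n = rank` — Serre's `s I₊ ⊕ t I₋`
  (*A Course in Arithmetic*, Ch. V §1.4.1) — and to `n⟨1⟩ = I₊ ⊕ ⋯ ⊕ I₊` (the standard form
  `Matrix.toBilin' 1` on `ℤⁿ`) if it is moreover positive definite, which is the form in which
  Donaldson's theorem is usually quoted (`Q_M ≅ n⟨1⟩`);
* on a finitely generated `V`, `Q` is diagonalisable over `ℤ` iff it is isometric to some diagonal
  form `Matrix.toBilin' (Matrix.diagonal d)` on `ℤⁿ`;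
* an **even** form with an orthogonal basis takes only even values (`Q x bⱼ = xⱼ Q bⱼ bⱼ` is even;
  expand `y`), so an even form with one odd value `Q x y` admits no orthogonal `ℤ`-basis — in
  particular a nonzero even unimodular form (type II versus the type I forms `s I₊ ⊕ t I₋`: Serre,
  Ch. V §1.3.4, §1.4, §2.1), or the `E₈` form (`E₈(e₀, e₂) = -1`).

## Sources

* J. Milnor, D. Husemoller, *Symmetric bilinear forms* (1973), Ch. I §3 (types I/II, the forms
  `⟨±1⟩`), Ch. II §2–§5.
* J.-P. Serre, *A Course in Arithmetic* (1973), Ch. V §1.3–§1.4 (invariants, type, `I₊`, `I₋`, `U`,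
  `E₈`), §2.1.
-/


open Module

namespace LinearMap.BilinForm

variable {V : Type*} [AddCommGroup V] [Module ℤ V] {Q : LinearMap.BilinForm ℤ V}

/-- In a `Q`-orthogonal basis of an *even* form, every value `Q x y` is even: each
`Q x bⱼ = xⱼ · Q bⱼ bⱼ` is even and `Q x y = Σⱼ yⱼ Q x bⱼ`. (Serre, *A Course in Arithmetic*,
Ch. V §1.3.4: the type of a form; a type II form has all `Q bᵢ bᵢ` even.) [folklore] -/
theorem even_apply_of_isEven_of_isOrthoᵢ {ι : Type*} {b : Basis ι ℤ V} (he : Q.IsEven)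
    (hb : LinearMap.IsOrthoᵢ Q b) (x y : V) : Even (Q x y) := by
  have h1 : ∀ j, Even (Q x (b j)) := fun j => by
    rw [apply_basis_eq_of_isOrthoᵢ hb]
    exact (he (b j)).mul_left _
  rw [apply_eq_sum_repr b x y, Finsupp.sum]
  exact Finset.even_sum _ fun j _ => (h1 j).mul_left _

/-- An even form that is diagonalisable over `ℤ` takes only even values. [folklore] -/
theorem IsDiagonalizable.even_apply (hd : Q.IsDiagonalizable) (he : Q.IsEven) (x y : V) :
    Even (Q x y) := by
  obtain ⟨ι, b, hb⟩ := hd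
  exact even_apply_of_isEven_of_isOrthoᵢ he hb x y

/-- An even form with an odd value `Q x y` is not diagonalisable over `ℤ` (no orthogonal
`ℤ`-basis). For unimodular forms this is the type obstruction: `U`, `E₈`, … are of type II while
`s I₊ ⊕ t I₋` is of type I (Serre, *A Course in Arithmetic*, Ch. V §1.4.1–1.4.3, §2.1).
[cite: Serre1973, Ch. V §2.1] -/
theorem not_isDiagonalizable_of_isEven_of_odd (he : Q.IsEven) {x y : V} (hxy : Odd (Q x y)) :
    ¬ Q.IsDiagonalizable := fun hd =>
  Int.not_even_iff_odd.mpr hxy (hd.even_apply he x y)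

/-- In a `Q`-orthogonal basis `b` of a **unimodular** form, every diagonal Gram entry `Q bᵢ bᵢ` is a
unit of `ℤ`: the coordinate functional `bᵢ*` is `Q x -` for some `x` (unimodularity), and
`1 = bᵢ*(bᵢ) = Q x bᵢ = xᵢ · Q bᵢ bᵢ`. Milnor–Husemoller (1973), Ch. I §3; Serre,
*A Course in Arithmetic*, Ch. V §1.4.1. [cite: MilnorHusemoller1973, Ch. I §3] -/
theorem isUnit_apply_self_of_isUnimodular_of_isOrthoᵢ {ι : Type*} {b : Basis ι ℤ V}
    (hu : Q.IsUnimodular) (hb : LinearMap.IsOrthoᵢ Q b) (i : ι) : IsUnit (Q (b i) (b i)) := by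
  haveI : Q.IsPerfPair := hu
  obtain ⟨x, hx⟩ := (LinearMap.IsPerfPair.bijective_left Q).2 (b.coord i)
  have h1 : Q x (b i) = 1 := by
    rw [hx, Basis.coord_apply, Basis.repr_self, Finsupp.single_eq_same]
  refine isUnit_of_dvd_one ⟨b.repr x i, ?_⟩
  rw [← h1, apply_basis_eq_of_isOrthoᵢ hb, mul_comm]

/-- In a `Q`-orthogonal basis of a unimodular form the diagonal Gram entries are `±1`.
Milnor–Husemoller (1973), Ch. I §3. [cite: MilnorHusemoller1973, Ch. I §3] -/
theorem apply_self_eq_one_or_eq_neg_one_of_isUnimodular_of_isOrthoᵢ {ι : Type*} {b : Basis ι ℤ V}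
    (hu : Q.IsUnimodular) (hb : LinearMap.IsOrthoᵢ Q b) (i : ι) :
    Q (b i) (b i) = 1 ∨ Q (b i) (b i) = -1 :=
  Int.isUnit_iff.mp (isUnit_apply_self_of_isUnimodular_of_isOrthoᵢ hu hb i)

/-- A **nonzero even unimodular** form is not diagonalisable over `ℤ`: a diagonal entry of an
orthogonal basis would be `±1`, which is odd. This is why type II lattices (`U`, `E₈`, `E₈ ⊕ E₈`,
…) are never `≅ s I₊ ⊕ t I₋` (Serre, *A Course in Arithmetic*, Ch. V §1.3.4, §2.1); combined with
Donaldson's theorem it excludes even definite forms as intersection forms of smooth 4-manifolds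
with `b₂ ≠ 0`. [cite: Serre1973, Ch. V §2.1] -/
theorem not_isDiagonalizable_of_isEven_of_isUnimodular [Nontrivial V] (he : Q.IsEven)
    (hu : Q.IsUnimodular) : ¬ Q.IsDiagonalizable := by
  rintro ⟨ι, b, hb⟩
  obtain ⟨i⟩ := b.index_nonempty
  obtain ⟨k, hk⟩ := he (b i)
  rcases apply_self_eq_one_or_eq_neg_one_of_isUnimodular_of_isOrthoᵢ hu hb i with h | h <;> omega

/-- A nonzero unimodular form that is diagonalisable over `ℤ` is odd (of type I): Serre's
`s I₊ ⊕ t I₋` are of type I (*A Course in Arithmetic*, Ch. V §1.4.1).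
[cite: Serre1973, Ch. V §1.4.1] -/
theorem IsDiagonalizable.isOdd_of_isUnimodular [Nontrivial V] (hd : Q.IsDiagonalizable)
    (hu : Q.IsUnimodular) : Q.IsOdd := fun he =>
  not_isDiagonalizable_of_isEven_of_isUnimodular he hu hd

/-- The Gram matrix of `Q` in a `Q`-orthogonal basis is the diagonal matrix of the `Q bᵢ bᵢ`.
[folklore] -/
theorem toMatrix_eq_diagonal_of_isOrthoᵢ {ι : Type*} [Fintype ι] [DecidableEq ι] {b : Basis ι ℤ V}
    (hb : LinearMap.IsOrthoᵢ Q b) :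
    BilinForm.toMatrix b Q = Matrix.diagonal fun i => Q (b i) (b i) := by
  ext i j
  rw [LinearMap.BilinForm.toMatrix_apply]
  by_cases hij : i = j
  · subst hij
    rw [Matrix.diagonal_apply_eq]
  · rw [Matrix.diagonal_apply_ne _ hij]
    exact hb hij

variable (Q) in
/-- A form on a lattice is isometric, via the coordinate isomorphism `V ≃ ℤⁿ` of a basis `b`, to the
matrix form `Matrix.toBilin'` of its Gram matrix in `b`. [folklore] -/
theorem equivalent_toBilin'_toMatrix {ι : Type*} [Fintype ι] [DecidableEq ι] (b : Basis ι ℤ V) :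
    Q.Equivalent (Matrix.toBilin' (BilinForm.toMatrix b Q)) :=
  ⟨{ b.equivFun with
      map_app' := fun x y => by
        change Matrix.toBilin' (BilinForm.toMatrix b Q) (b.equivFun x) (b.equivFun y) = Q x y
        rw [Matrix.toBilin'_apply', b.equivFun_apply, b.equivFun_apply,
          ← LinearMap.BilinForm.apply_eq_dotProduct_toMatrix_mulVec b Q x y] }⟩

/-- On a finitely generated `V`, a form diagonalisable over `ℤ` has an orthogonal basis indexed by
`Fin (rank V)`. [folklore] -/
theorem IsDiagonalizable.exists_basis_fin_isOrthoᵢ [Module.Finite ℤ V] (hd : Q.IsDiagonalizable) :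
    ∃ b : Basis (Fin (finrank ℤ V)) ℤ V, LinearMap.IsOrthoᵢ Q b := by
  obtain ⟨ι, b, hb⟩ := hd
  haveI : Finite ι := Module.Finite.finite_basis b
  letI : Fintype ι := Fintype.ofFinite ι
  have hn : finrank ℤ V = Fintype.card ι := Module.finrank_eq_card_basis b
  refine ⟨b.reindex ((Fintype.equivFin ι).trans (finCongr hn.symm)), fun i j hij => ?_⟩
  simp only [Function.onFun, Basis.reindex_apply]
  exact hb fun h => hij (by simpa using congrArg ((Fintype.equivFin ι).trans (finCongr hn.symm)) h)

/-- **Characterisation.** On a finitely generated `ℤ`-module, `Q` is diagonalisable over `ℤ` iff it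
is isometric to a diagonal form `⊕ᵢ ⟨dᵢ⟩ = Matrix.toBilin' (Matrix.diagonal d)` on some `ℤⁿ`
(then necessarily `n = rank V`). [folklore] -/
theorem isDiagonalizable_iff_exists_equivalent_toBilin'_diagonal [Module.Finite ℤ V] :
    Q.IsDiagonalizable ↔
      ∃ (n : ℕ) (d : Fin n → ℤ), Q.Equivalent (Matrix.toBilin' (Matrix.diagonal d)) := by
  constructor
  · intro hd
    obtain ⟨b, hb⟩ := hd.exists_basis_fin_isOrthoᵢ
    refine ⟨finrank ℤ V, fun i => Q (b i) (b i), ?_⟩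
    rw [← toMatrix_eq_diagonal_of_isOrthoᵢ hb]
    exact equivalent_toBilin'_toMatrix Q b
  · rintro ⟨n, d, h⟩
    exact (isDiagonalizable_iff_of_equivalent h).mpr
      (Literature.Topology.FourManifolds.isDiagonalizable_toBilin'_diagonal d)

/-- **`Q ≅ ⊕ ⟨±1⟩`.** A unimodular form on a lattice that is diagonalisable over `ℤ` is isometric to
a diagonal form `⟨d₁⟩ ⊕ ⋯ ⊕ ⟨dₙ⟩` on `ℤⁿ`, `n = rank V`, with all `dᵢ = ±1` — Serre's
`s I₊ ⊕ t I₋` (*A Course in Arithmetic*, Ch. V §1.4.1); Milnor–Husemoller (1973), Ch. I §3.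
[cite: MilnorHusemoller1973, Ch. I §3] -/
theorem IsDiagonalizable.exists_equivalent_toBilin'_diagonal_of_isUnimodular [Module.Finite ℤ V]
    (hd : Q.IsDiagonalizable) (hu : Q.IsUnimodular) :
    ∃ d : Fin (finrank ℤ V) → ℤ, (∀ i, d i = 1 ∨ d i = -1) ∧
      Q.Equivalent (Matrix.toBilin' (Matrix.diagonal d)) := by
  obtain ⟨b, hb⟩ := hd.exists_basis_fin_isOrthoᵢ
  refine ⟨fun i => Q (b i) (b i),
    fun i => apply_self_eq_one_or_eq_neg_one_of_isUnimodular_of_isOrthoᵢ hu hb i, ?_⟩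
  rw [← toMatrix_eq_diagonal_of_isOrthoᵢ hb]
  exact equivalent_toBilin'_toMatrix Q b

/-- **`Q ≅ n⟨1⟩`.** A positive definite unimodular form on a lattice that is diagonalisable over `ℤ`
is isometric to the standard form `Matrix.toBilin' 1` (`= I₊ ⊕ ⋯ ⊕ I₊`, the sum of squares) on
`ℤⁿ`, `n = rank V`: the diagonal entries are `±1` and positive. This is the usual phrasing of the
conclusion of Donaldson's theorem. Serre, *A Course in Arithmetic*, Ch. V §1.4.1;
Milnor–Husemoller (1973), Ch. I §3. [cite: MilnorHusemoller1973, Ch. I §3] -/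
theorem IsDiagonalizable.equivalent_toBilin'_one_of_posDef [Module.Finite ℤ V]
    (hd : Q.IsDiagonalizable) (hu : Q.IsUnimodular) (hp : Q.PosDef) :
    Q.Equivalent (Matrix.toBilin' (1 : Matrix (Fin (finrank ℤ V)) (Fin (finrank ℤ V)) ℤ)) := by
  obtain ⟨b, hb⟩ := hd.exists_basis_fin_isOrthoᵢ
  have h1 : ∀ i, Q (b i) (b i) = 1 := fun i => by
    have hpos : 0 < Q (b i) (b i) := (posDef_iff Q).mp hp (b i) (b.ne_zero i)
    rcases apply_self_eq_one_or_eq_neg_one_of_isUnimodular_of_isOrthoᵢ hu hb i with h | h <;> omega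
  have hM : BilinForm.toMatrix b Q = 1 := by
    rw [toMatrix_eq_diagonal_of_isOrthoᵢ hb, ← Matrix.diagonal_one]
    exact congrArg Matrix.diagonal (funext h1)
  rw [← hM]
  exact equivalent_toBilin'_toMatrix Q b

/-- **`Q ≅ n⟨-1⟩`.** A negative definite unimodular form on a lattice that is diagonalisable over
`ℤ` is isometric to minus the standard form, `Matrix.toBilin' (-1)` on `ℤⁿ`, `n = rank V`.
Serre, *A Course in Arithmetic*, Ch. V §1.4.1; Milnor–Husemoller (1973), Ch. I §3.
[cite: MilnorHusemoller1973, Ch. I §3] -/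
theorem IsDiagonalizable.equivalent_toBilin'_neg_one_of_negDef [Module.Finite ℤ V]
    (hd : Q.IsDiagonalizable) (hu : Q.IsUnimodular) (hn : Q.NegDef) :
    Q.Equivalent (Matrix.toBilin' (-1 : Matrix (Fin (finrank ℤ V)) (Fin (finrank ℤ V)) ℤ)) := by
  obtain ⟨b, hb⟩ := hd.exists_basis_fin_isOrthoᵢ
  have h1 : ∀ i, Q (b i) (b i) = -1 := fun i => by
    have hneg : Q (b i) (b i) < 0 := (negDef_iff Q).mp hn (b i) (b.ne_zero i)
    rcases apply_self_eq_one_or_eq_neg_one_of_isUnimodular_of_isOrthoᵢ hu hb i with h | h <;> omega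
  have hM : BilinForm.toMatrix b Q = -1 := by
    rw [toMatrix_eq_diagonal_of_isOrthoᵢ hb, ← Matrix.diagonal_one, Matrix.diagonal_neg]
    exact congrArg Matrix.diagonal (funext h1)
  rw [← hM]
  exact equivalent_toBilin'_toMatrix Q b

end LinearMap.BilinForm

namespace Literature.Topology.FourManifolds

open LinearMap.BilinForm

/-- The `E₈` lattice form is **not** diagonalisable over `ℤ`: it is even (`isEven_e8Form`) and takes
the odd value `E₈(e₀, e₂) = -1`, an off-diagonal Cartan entry
(`not_isDiagonalizable_of_isEven_of_odd`); as a unimodular form it is of type II, unlike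
`s I₊ ⊕ t I₋` (Serre, *A Course in Arithmetic*, Ch. V §1.4.3, §2.1). With Donaldson's theorem:
`E₈` (and `E₈ ⊕ E₈`) is not the intersection form of a closed smooth oriented 4-manifold.
[cite: Serre1973, Ch. V §1.4.3] -/
theorem not_isDiagonalizable_e8Form : ¬ e8Form.IsDiagonalizable :=
  not_isDiagonalizable_of_isEven_of_odd isEven_e8Form (x := Pi.single 0 1) (y := Pi.single 2 1)
    (by rw [e8Form, Matrix.toBilin'_single]; decide)

/-- Hence the `E₈` form is not isometric to any diagonal form `⊕ᵢ ⟨dᵢ⟩` on `ℤⁿ` (in particular not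
to `8⟨1⟩ = I₊⁸`, although both are positive definite unimodular of rank `8`).
[cite: Serre1973, Ch. V §1.4.3] -/
theorem not_equivalent_e8Form_toBilin'_diagonal {n : Type} [Fintype n] [DecidableEq n]
    (d : n → ℤ) : ¬ e8Form.Equivalent (Matrix.toBilin' (Matrix.diagonal d)) := fun h =>
  not_isDiagonalizable_e8Form
    ((isDiagonalizable_iff_of_equivalent h).mpr (isDiagonalizable_toBilin'_diagonal d))

end Literature.Topology.FourManifolds
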